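import Summits.ResolutionOfSingularities.ResolutionOfSingularities.Theorems.WeightedInvariantIota3JSigmaDominanceUpgrade
import HarnessLib

/-!
# (o70-b) PART 2e — AT MAXIMAL RATIO AND `q < r₂` THE FIRST FACE CARRIES A SECOND-MEMBER TERM ((M2), ideal form)
# (door `HypersurfaceCentreConstruction`, stmt-ResolutionOfSingularities-19897; clause h8 ⟸ (σ-pres)₃ ⟸ (o70-a) + (o70-b) + (o70-x);
# SPEC (Δ12) rev 4 `L/res-L1-w43-plan-1/JSigmaCanon_sketch.lean` d065476ee61016ce (l.224 / l.249) of res-L1-w43-plan-1; hand res-D-brk-1)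

Topic: `Summits/ResolutionOfSingularities/ResolutionOfSingularities/Theorems`. Helper for the door item
`HypersurfaceCentreConstruction` (stmt-ResolutionOfSingularities-19897, route `WeightedInvariant`), line `local-engine`
(L W4.3), def-free.  Second structural input of the residue of (J-can) (memo `D/res-D-brk-1/O70B-JCAN-PLAN.md` §1 (M2)): with
`𝔪 = (x, g₂, g₁)` and weights `(q; r₁, r₂)`, `q < r₂ ≤ r₁`, an element of level `N = r₁ν` lies in
`(g₁^ν) ⊔ x·F(N − q) ⊔ F(N + 1)` exactly when its weight-`N` initial form is `c·Y^ν + X·(…)` — NO monomial `g₂^b g₁^a` (`b ≥ 1`) on the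
first face.  If `f` were of that shape, the perturbed triple `(Mq + N; M r₁, M r₂ − 1)`, `M = N + 1` (ratio `> r₁/r₂`, still admissible because
`q < r₂`) would be reached by the SAME flag — against ratio-maximality.  The hypothesis is the RATIO clause only (the shape of SPEC rev 4 l.224
`TwoFlagDominanceAtLevelAt`: `∀` reached admissible `T'`, `r₁'·r₂ ≤ r₁·r₂'`); the `q`-clause of σ-maximality is not used.

* `weightedMonomialIdeal_le_of_weights`, `span_singleton_mul_weightedMonomialIdeal_le` — generator-wise transfer between weight systems;
* `perturbed_weight_eq`, `le_perturbed_weight_mul`, `le_perturbed_weight_succ` — the exponent bookkeeping of the perturbation;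
* `not_mem_span_pow_sup_of_ratio_max` — **(M2)**: `f ∉ (g₁^ν) ⊔ (x)·F(N − q) ⊔ F(N + 1)`.

[OURS · L1 W4.3 · (o70-b) PART 2e]  Replaces the role of NO printed item; NOT a statement of the manuscript
[claim: Hironaka2017, status: under-review]. AI work, weaker than expert review.  No named facts.
-/

noncomputable section

set_option linter.dupNamespace false -- mandated namespace `Summit.<Summit>.<Problem>` of this single-conjunct summit

open IsLocalRing Literature.AlgebraicGeometry.Resolution
open Summit.ResolutionOfSingularities.ResolutionOfSingularities.Theorems

namespace Summit.ResolutionOfSingularities.ResolutionOfSingularities.Cruxes.HypersurfaceCentreConstruction.LocalEngine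

namespace Iota3

universe u

/-! ## §0 Transfer between weight systems, generator by generator -/

section Transfer

variable {A : Type u} [CommRing A] {m : ℕ}

/-- If every exponent of `w`-weight `≥ n` has `w'`-weight `≥ n'`, then `𝒥ₙ(u; w) ≤ 𝒥_{n'}(u; w')`. [folklore] -/
theorem weightedMonomialIdeal_le_of_weights (u : Fin m → A) {w w' : Fin m → ℕ} {n n' : ℕ}
    (H : ∀ α : Fin m → ℕ, n ≤ ∑ i, w i * α i → n' ≤ ∑ i, w' i * α i) :
    weightedMonomialIdeal u w n ≤ weightedMonomialIdeal u w' n' := by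
  unfold weightedMonomialIdeal
  refine Ideal.span_le.mpr ?_
  rintro _ ⟨α, hα, rfl⟩
  exact Ideal.subset_span ⟨α, H α hα, rfl⟩

/-- Multiplying by the parameter `u i₀`: if every exponent `α` of `w`-weight `≥ n` has `w' i₀ + Σ w' α ≥ n'`, then
`(u i₀) · 𝒥ₙ(u; w) ≤ 𝒥_{n'}(u; w')`. [folklore] -/
theorem span_singleton_mul_weightedMonomialIdeal_le (u : Fin m → A) (i₀ : Fin m) {w w' : Fin m → ℕ} {n n' : ℕ}
    (H : ∀ α : Fin m → ℕ, n ≤ ∑ i, w i * α i → n' ≤ w' i₀ + ∑ i, w' i * α i) :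
    Ideal.span {u i₀} * weightedMonomialIdeal u w n ≤ weightedMonomialIdeal u w' n' := by
  have key : ∀ s ∈ weightedMonomialIdeal u w n, u i₀ * s ∈ weightedMonomialIdeal u w' n' := by
    intro s hs
    unfold weightedMonomialIdeal at hs
    refine Submodule.span_induction ?_ ?_ ?_ ?_ hs
    · rintro _ ⟨α, hα, rfl⟩
      have h1 := self_mem_weightedMonomialIdeal u w' i₀
      have h2 := prod_pow_mem_weightedMonomialIdeal u w' α le_rfl
      exact weightedMonomialIdeal_antitone u w' (H α hα)
        (weightedMonomialIdeal_mul_le u w' _ _ (Ideal.mul_mem_mul h1 h2))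
    · rw [mul_zero]; exact Ideal.zero_mem _
    · intro a b _ _ ha hb
      rw [mul_add]; exact Ideal.add_mem _ ha hb
    · intro r a _ ha
      rw [smul_eq_mul, mul_left_comm]
      exact Ideal.mul_mem_left _ r ha
  refine Ideal.mul_le.mpr fun r hr s hs => ?_
  obtain ⟨t, rfl⟩ := Ideal.mem_span_singleton'.mp hr
  rw [mul_assoc]
  exact Ideal.mul_mem_left _ t (key s hs)

end Transfer

/-! ## §1 Bookkeeping of the perturbed weights `(Mq + N; M r₁, M r₂ − 1)`, `M = N + 1` -/

/-- Core identity of the perturbation `(Mq + N; M r₁, M r₂ − 1)`: for a monomial of weight `W = qc + r₂b + r₁a` the perturbed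
weight plus `b` is `M·W + N·c`. [folklore] -/
theorem perturbed_weight_eq {q r₁ r₂ M Nn c b a : ℕ} (hM : 1 ≤ M) (hr₂ : 1 ≤ r₂) :
    ((M * q + Nn) * c + (M * r₂ - 1) * b + (M * r₁) * a) + b = M * (q * c + r₂ * b + r₁ * a) + Nn * c := by
  have h1 : 1 ≤ M * r₂ := Nat.one_le_iff_ne_zero.mpr (Nat.mul_ne_zero (by omega) (by omega))
  zify [h1]
  ring

/-- (ii) of (M2): `x` times a monomial of weight `≥ N − q` reaches the perturbed level `M·N` (`M = N + 1`, `2 ≤ r₂`, `q ≤ N`). [folklore] -/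
theorem le_perturbed_weight_mul {q r₁ r₂ N c b a : ℕ} (hr₂ : 2 ≤ r₂) (hqN : q ≤ N)
    (hw : N - q ≤ q * c + r₂ * b + r₁ * a) :
    (N + 1) * N ≤ ((N + 1) * q + N) + (((N + 1) * q + N) * c + ((N + 1) * r₂ - 1) * b + ((N + 1) * r₁) * a) := by
  have e := perturbed_weight_eq (q := q) (r₁ := r₁) (r₂ := r₂) (Nn := N) (c := c) (b := b) (a := a)
    (M := N + 1) (by omega) (by omega)
  have hW : (N + 1) * (N - q) ≤ (N + 1) * (q * c + r₂ * b + r₁ * a) := Nat.mul_le_mul_left _ hw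
  have hsub : (N + 1) * (N - q) + (N + 1) * q = (N + 1) * N := by
    rw [← Nat.mul_add, Nat.sub_add_cancel hqN]
  rcases le_or_gt b N with hb | hb
  · omega
  · have h2 : 2 * b ≤ r₂ * b := Nat.mul_le_mul_right b hr₂
    have h3 : (N + 1) * (2 * b) ≤ (N + 1) * (r₂ * b) := Nat.mul_le_mul_left _ h2
    have h4 : (N + 1) * (r₂ * b) ≤ (N + 1) * (q * c + r₂ * b + r₁ * a) := Nat.mul_le_mul_left _ (by omega)
    have h5 : (N + 1) * (N + 1) ≤ (N + 1) * b := Nat.mul_le_mul_left _ hb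
    have h6 : (N + 1) * (2 * b) = (N + 1) * b + (N + 1) * b := by ring
    have h7 : (N + 1) * N ≤ (N + 1) * (N + 1) := Nat.mul_le_mul_left _ (Nat.le_succ N)
    have h8 : b ≤ (N + 1) * b := Nat.le_mul_of_pos_left b (Nat.succ_pos N)
    omega

/-- (iii) of (M2): a monomial of weight `≥ N + 1` reaches the perturbed level `M·N` (`M = N + 1`, `2 ≤ r₂`). [folklore] -/
theorem le_perturbed_weight_succ {q r₁ r₂ N c b a : ℕ} (hr₂ : 2 ≤ r₂) (hw : N + 1 ≤ q * c + r₂ * b + r₁ * a) :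
    (N + 1) * N ≤ ((N + 1) * q + N) * c + ((N + 1) * r₂ - 1) * b + ((N + 1) * r₁) * a := by
  have e := perturbed_weight_eq (q := q) (r₁ := r₁) (r₂ := r₂) (Nn := N) (c := c) (b := b) (a := a)
    (M := N + 1) (by omega) (by omega)
  have hW : (N + 1) * (N + 1) ≤ (N + 1) * (q * c + r₂ * b + r₁ * a) := Nat.mul_le_mul_left _ hw
  rcases le_or_gt b (N + 1) with hb | hb
  · have h7 : (N + 1) * N + (N + 1) = (N + 1) * (N + 1) := by ring
    omega
  · have h2 : 2 * b ≤ r₂ * b := Nat.mul_le_mul_right b hr₂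
    have h3 : (N + 1) * (2 * b) ≤ (N + 1) * (r₂ * b) := Nat.mul_le_mul_left _ h2
    have h4 : (N + 1) * (r₂ * b) ≤ (N + 1) * (q * c + r₂ * b + r₁ * a) := Nat.mul_le_mul_left _ (by omega)
    have h5 : (N + 1) * (N + 1) ≤ (N + 1) * b := Nat.mul_le_mul_left _ hb.le
    have h6 : (N + 1) * (2 * b) = (N + 1) * b + (N + 1) * b := by ring
    have h7 : (N + 1) * N ≤ (N + 1) * (N + 1) := Nat.mul_le_mul_left _ (Nat.le_succ N)
    have h8 : b ≤ (N + 1) * b := Nat.le_mul_of_pos_left b (Nat.succ_pos N)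
    omega

/-! ## §2 (M2): the first face carries a second-member term -/

section FirstFace

variable {S : Type u} [CommRing S] [IsLocalRing S]

/-- **(M2) At maximal ratio with `q < r₂` the first face of `f` carries a `g₂`-term.**  Let `𝔪 = (x, g₂, g₁)`, `(g₁, g₂)` a two-flag,
`0 < q < r₂ ≤ r₁`, `0 < ν`, `N = r₁ν`, and suppose NO admissible triple reached by `f` (at order `ν`) has ratio `> r₁/r₂`.  Then
`f ∉ (g₁^ν) ⊔ (x)·F(N − q) ⊔ F(N + 1)` — otherwise the same flag reaches the admissible triple `(Mq + N; M r₁, M r₂ − 1)`, `M = N + 1`, of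
ratio `M r₁/(M r₂ − 1) > r₁/r₂`. [OURS · L1 W4.3 · (o70-b)] -/
theorem not_mem_span_pow_sup_of_ratio_max {x g₁ g₂ f : S} {q r₁ r₂ ν : ℕ} (h𝔪 : Ideal.span {x, g₂, g₁} = maximalIdeal S)
    (hq : 0 < q) (hqr₂ : q < r₂) (h₂₁ : r₂ ≤ r₁) (hν : 0 < ν) (hΦ : IsTwoFlag g₁ g₂)
    (hrat : ∀ q' r₁' r₂' : ℕ, AdmissibleTriple q' r₁' r₂' → FlagReaches f ν q' r₁' r₂' → r₁' * r₂ ≤ r₁ * r₂') :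
    f ∉ (Ideal.span {g₁ ^ ν} ⊔ Ideal.span {x} * flagContactFiltration g₁ g₂ q r₁ r₂ (r₁ * ν - q)) ⊔
      flagContactFiltration g₁ g₂ q r₁ r₂ (r₁ * ν + 1) := by
  intro hf
  set N := r₁ * ν with hN
  set M := N + 1 with hM
  have hr₂2 : 2 ≤ r₂ := by omega
  have hqN : q ≤ N := by
    have : r₁ ≤ r₁ * ν := Nat.le_mul_of_pos_right r₁ hν
    omega
  -- the perturbed triple
  have hadm' : AdmissibleTriple (M * q + N) (M * r₁) (M * r₂ - 1) := by
    refine ⟨by omega, ?_, ?_⟩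
    · have h1 : M * (q + 1) ≤ M * r₂ := Nat.mul_le_mul_left M hqr₂
      have h2 : M * (q + 1) = M * q + (N + 1) := by rw [hM]; ring
      omega
    · exact (Nat.sub_le _ _).trans (Nat.mul_le_mul_left M h₂₁)
  have hq' : 0 < M * q + N := hadm'.1
  have hq₂' : M * q + N ≤ M * r₂ - 1 := hadm'.2.1
  have hq₁' : M * q + N ≤ M * r₁ := hq₂'.trans hadm'.2.2
  -- the level `(M r₁) ν = M N` of the perturbed filtration of the same flag
  have hlevel : M * r₁ * ν = M * N := by rw [hN]; ring
  have hreach : f ∈ flagContactFiltration g₁ g₂ (M * q + N) (M * r₁) (M * r₂ - 1) (M * r₁ * ν) := by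
    rw [hlevel]
    obtain ⟨cx, hcx, f₁, hf₁, hsum⟩ := Submodule.mem_sup.mp hf
    obtain ⟨cg, hcg, xh, hxh, hsum₂⟩ := Submodule.mem_sup.mp hcx
    rw [← hsum, ← hsum₂]
    refine Ideal.add_mem _ (Ideal.add_mem _ ?_ ?_) ?_
    · -- `c g₁^ν`
      obtain ⟨c, rfl⟩ := Ideal.mem_span_singleton'.mp hcg
      exact Ideal.mul_mem_left _ c (pow_left_mem_flagContactFiltration hq' hlevel.symm.le)
    · -- `x · F(N − q)`
      have hle : Ideal.span {x} * flagContactFiltration g₁ g₂ q r₁ r₂ (N - q) ≤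
          flagContactFiltration g₁ g₂ (M * q + N) (M * r₁) (M * r₂ - 1) (M * N) := by
        rw [flagContactFiltration_eq_weightedMonomialIdeal h𝔪 hq hqr₂.le (hqr₂.le.trans h₂₁),
          flagContactFiltration_eq_weightedMonomialIdeal h𝔪 hq' hq₂' hq₁']
        refine span_singleton_mul_weightedMonomialIdeal_le ![x, g₂, g₁] 0 fun α hα => ?_
        simp only [Fin.sum_univ_three, Matrix.cons_val_zero, Matrix.cons_val_one, Matrix.cons_val_two, Matrix.head_cons,
          Matrix.tail_cons] at hα ⊢
        rw [hM]
        exact le_perturbed_weight_mul hr₂2 hqN hα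
      exact hle hxh
    · -- `F(N + 1)`
      have hle : flagContactFiltration g₁ g₂ q r₁ r₂ (N + 1) ≤
          flagContactFiltration g₁ g₂ (M * q + N) (M * r₁) (M * r₂ - 1) (M * N) := by
        rw [flagContactFiltration_eq_weightedMonomialIdeal h𝔪 hq hqr₂.le (hqr₂.le.trans h₂₁),
          flagContactFiltration_eq_weightedMonomialIdeal h𝔪 hq' hq₂' hq₁']
        refine weightedMonomialIdeal_le_of_weights ![x, g₂, g₁] fun α hα => ?_
        simp only [Fin.sum_univ_three, Matrix.cons_val_zero, Matrix.cons_val_one, Matrix.cons_val_two, Matrix.head_cons,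
          Matrix.tail_cons] at hα ⊢
        rw [hM]
        exact le_perturbed_weight_succ hr₂2 hα
      exact hle hf₁
  -- ratio-maximality is violated
  have key := hrat _ _ _ hadm' ⟨g₁, g₂, hΦ, hreach⟩
  have h1 : 1 ≤ M * r₂ := Nat.one_le_iff_ne_zero.mpr (Nat.mul_ne_zero (by omega) (by omega))
  have h2 : r₁ * (M * r₂ - 1) + r₁ = M * r₁ * r₂ := by
    zify [h1]
    ring
  have h3 : 0 < r₁ := by omega
  omega

end FirstFace

end Iota3

end Summit.ResolutionOfSingularities.ResolutionOfSingularities.Cruxes.HypersurfaceCentreConstruction.LocalEngine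

end
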